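import Summits.ValiantsHypothesis.ValiantsHypothesis.Theorems.KPlusLogSqLawTropicalShiftThreeDefs

/-!
# Route «KPlusLogSqLaw» — the explicit `K = 4` tropical family SHIFT-SQUARE: definitions

HONEST FRAMING.  Definitions-only file (D-0009) of a helper chain `--supports` the crux
`Summit.ValiantsHypothesis.ValiantsHypothesis.Theses.KPlusLogSqLaw.TropicalB` (ledger item `stmt-ValiantsHypothesis-19771`, route
`KPlusLogSqLaw`; object-search cell `pub-symmetroid`, seat val-sym-trop-p5 g8, 2026-08-27).  It names ONE explicit tropical design per
format `(m, 4)`, `m = n + 1 ≥ 1`, in the tree's dominance vocabulary (`tropWeight`, `termSign`, `IsDominant` of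
`MatrixDescartesFalseOfTropicalMonster.lean`), the grid of its intended optima and the bookkeeping functions of the proof; nothing is
proved here (the companion files `…TropicalShiftSquare.lean` / `…TropicalShiftSquareChain.lean` prove that the design has `(m+1)²`
sign-alternating unique optima, whence `TropicalCensus.TropRootLawAt m 4 B → (m+1)² − 1 ≤ B`, and that this MEETS the parallelogram
ceiling `KPlusLogSqLaw.Sumset.chain_succ_le_parallelogram` of the additive exponent type `{d₀, d₀+g₁, d₀+g₂, d₀+g₁+g₂}`).  These are
concrete witnesses, not notions: no statement of the route depends on them.  Nothing here asserts `TropicalB`, `WeakLifting`,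
`KPlusLogSqLaw`, `MatrixDescartes` or anything about `VP ≠ VNP`; the cell's `K = 4` fork (quadratic versus cubic growth of the
tropical row `T(m,4)`) is untouched — the family is quadratic.

THE DESIGN (SHIFT-THREE of val-sym-lift-p3, `…TropicalShiftThreeDefs.lean`, with the low bit offered on EVERY entry; the four classes
are read as two bits `(H, L)`: `0 = (0,0)`, `1 = (0,1)`, `2 = (1,0)`, `3 = (1,1)`).  Nodes `Fin (n+1)`, exponents `d = (0, 1, D, D+1)`,
`D = m(2m+3)` (`dd`; `ShiftThree.bigD`) — an exponent PARALLELOGRAM.  The entry in row `a` and column `b` has SHIFT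
`q = a − b (mod m) ∈ [0, m)` (`ShiftThree.shiftZ`) and WRAPS iff `a < b`.  Presence/signs (`ee`): a wrapping entry carries the two
HIGH classes `2, 3`, an entry below the diagonal (`b < a`) the two LOW classes `0, 1`, a diagonal entry all four; the sign of a
present incidence is `−1` for the odd (low-bit) classes `1, 3` and `+1` for `0, 2` (`lsign`) — no phase-sign gadget is needed.  The
EFFECTIVE SHIFT of an incidence (`eshift`) is its shift, except that the high classes ON THE DIAGONAL count as shift `m` (in the
zero-sum gauge `θ(2m+3)·shift − θ·D·[wrap]` a diagonal high incidence scores `θ·D = θ(2m+3)·m`, exactly like a shift-`m` entry).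
Valuations (`vv`): every incidence pays `pen q = (2m+3)(m+1)·q(q+1)` at its effective shift (`ShiftThree.pen`), a low-bit incidence
additionally the price `L·q + 2(b+1)`, `L = 2(m+1)` (`ShiftThree.price`).  Grid: phase `p ≤ m` (ALL `m + 1` phases, the last one
being the identity at the high level), step `a ≤ m`, slope `θ(p,a) = L·p + 2a + 1` (`ShiftThree.th`), term `cterm p a = (σ_p, λ_{p,a})`
with `σ_p = ρ^p`, `ρ` the rotation `b ↦ b + 1` (`rot`, a power of Mathlib's `finRotate`, so that `sign σ_p = ((−1)^n)^p` is available),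
and `λ_{p,a}` (`lam`) = high bit on the columns with `b + p ≥ m` (the wrapping ones; all of them in phase `m`), low bit on the columns
`b < a`.  The grid is the full square `[0, m] × [0, m]`, enumerated by `grid k = (k / (m+1), k % (m+1))`; `phi` is the per-incidence
score in the gauge and `ShiftThree.gval θ q = θ(2m+3)q − pen q` its shift part; `lowDigit` / `highDigit` are the two bits as digits `≤ 1`
(the exponent set is the parallelogram `d l = 0 + lowDigit l · 1 + highDigit l · D`).
-/

set_option linter.dupNamespace false
set_option autoImplicit false

namespace Summit.ValiantsHypothesis.ValiantsHypothesis.Theorems.LacunarySymmetroidMatrixDescartes.TropicalCensus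

open Summit.ValiantsHypothesis.ValiantsHypothesis.Theorems.MatrixDescartes.Negative
open scoped BigOperators
open Finset

namespace ShiftSquare

open ShiftThree (bigD shiftZ pen price th gval)

variable (n : ℕ)

/-- exponents `d = (0, 1, D, D + 1)`: class `l` is worth `D·[2 ≤ l] + [l odd]`. -/
def dd : Fin 4 → ℕ := ![0, 1, bigD n, bigD n + 1]

/-- the EFFECTIVE SHIFT of the incidence `(a, b, l)`: the shift `a − b (mod m)` of the entry, except that a HIGH class on the
DIAGONAL counts as shift `m`. -/
def eshift (a b : Fin (n + 1)) (l : Fin 4) : ℤ :=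
  if (a : ℕ) = (b : ℕ) ∧ 2 ≤ (l : ℕ) then ((n : ℤ) + 1) else shiftZ n a b

/-- valuations: every incidence pays the penalty of its effective shift, a low-bit (odd) class additionally its price. -/
def vv : Fin (n + 1) → Fin (n + 1) → Fin 4 → ℤ := fun a b l =>
  pen n (eshift n a b l) + if (l : ℕ) % 2 = 1 then price n (eshift n a b l) b else 0

/-- the sign of a present incidence: `−1` for the low-bit classes `1, 3`, `+1` for `0, 2`. -/
def lsign (l : Fin 4) : ℤ := if (l : ℕ) % 2 = 1 then -1 else 1

/-- presence/sign pattern: a wrapping entry (`a < b`) carries the HIGH classes `2, 3`, an entry below the diagonal the LOW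
classes `0, 1`, a diagonal entry all four classes; present incidences are signed by `lsign`. -/
def ee : Fin (n + 1) → Fin (n + 1) → Fin 4 → ℤ := fun a b l =>
  if (a : ℕ) < (b : ℕ) then (if 2 ≤ (l : ℕ) then lsign l else 0)
  else if (a : ℕ) = (b : ℕ) then lsign l
  else (if 2 ≤ (l : ℕ) then 0 else lsign l)

/-- the phase permutation `σ_p = ρ^p`, `ρ = finRotate m` the rotation `b ↦ b + 1`; `σ_m = 1`. -/
def rot (p : ℕ) : Equiv.Perm (Fin (n + 1)) := (finRotate (n + 1)) ^ p

/-- the class map of the grid point `(p, a)`: high bit on the columns `b` with `b + p ≥ m` (the wrapping columns of `σ_p`; every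
column when `p = m`), low bit on the columns `b < a`. -/
def lam (p a : ℕ) : Fin (n + 1) → Fin 4 := fun b =>
  if n + 1 ≤ (b : ℕ) + p then (if (b : ℕ) < a then 3 else 2) else (if (b : ℕ) < a then 1 else 0)

/-- the Leibniz term of the grid point `(p, a)`. -/
def cterm (p a : ℕ) : Equiv.Perm (Fin (n + 1)) × (Fin (n + 1) → Fin 4) := (rot n p, lam n p a)

/-- per-incidence score at slope `θ`, corrected by the zero-sum gauge `θ·(2m+3)·shift − θ·D·[wrap]`. -/
def phi (θ : ℤ) (a b : Fin (n + 1)) (l : Fin 4) : ℤ :=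
  θ * (dd n l : ℤ) - vv n a b l + θ * (2 * n + 5) * shiftZ n a b -
    θ * (bigD n : ℤ) * (if (a : ℕ) < (b : ℕ) then 1 else 0)

/-- the `k`-th grid point `(p_k, a_k) = (k / (m+1), k % (m+1))` of the square `[0, m] × [0, m]`, read lexicographically. -/
def grid (k : ℕ) : ℕ × ℕ := (k / (n + 2), k % (n + 2))

/-- the low-bit digit `[l odd]` of a class (digit form of the exponent parallelogram). -/
def lowDigit (l : Fin 4) : ℕ := if (l : ℕ) % 2 = 1 then 1 else 0

/-- the high-bit digit `[2 ≤ l]` of a class (digit form of the exponent parallelogram). -/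
def highDigit (l : Fin 4) : ℕ := if 2 ≤ (l : ℕ) then 1 else 0

end ShiftSquare

end Summit.ValiantsHypothesis.ValiantsHypothesis.Theorems.LacunarySymmetroidMatrixDescartes.TropicalCensus
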